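import Summits.KontsevichZagierPeriods.KontsevichZagierPeriods.Theses.InverseLandau

/-!
# Sketch — crux-ideate round 1, ideator 1, crux `TateFamilyKernelCurves` (stmt-KontsevichZagierPeriods-9132)

First-lemma signatures of the three idea cards (they must ELABORATE; nothing here is proved):

* `ArgBalancingRelator`      — card `root-argument-balancing` (2-D Stokes certificate in an auxiliary
                                 cube variable, explicit rational null-homotopy of the root configuration);
* `AlgCoeffKernelDimOne`     — the common TRANSFER C⁺ of cards `root-argument-balancing` and
                                 `arc-concatenation-ratcircle` (Baker at the fibre makes ϖ disappear);
* `TateSlabLoopCertificate`  — card `tate-slab-stokes` (the family parameter ϖ is the Stokes variable,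
                                 the Tate fibre ϖ = 0 is the constant loop);
* `ArctanArcScissors`        — card `arc-concatenation-ratcircle` (1-D circle scissors on `KZ.ratCircle`
                                 coordinates; LowDimension's engine pointed at this crux).
-/

namespace Summit.KontsevichZagierPeriods.KontsevichZagierPeriods.Cruxes.TateFamilyKernelCurves.Sketch

open Literature.NumberTheory.Transcendental

/-- CARD 1, first lemma (ARG-BALANCING RELATOR). Poles `p j ∈ ℚ̄ ⊂ ℂ` off `[0,1]`, integer
multiplicities `n j`, and the winding-zero hypothesis `∑ n_j · Arg((p_j − 1)/p_j) = 0`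
(`∫₀¹ Im dz/(z − p) = Arg((p−1)/p)`, principal argument, since `[0,1]` subtends an angle `< π` at `p`).
Conclusion: the argument part `z ↦ ∑ n_j Im(1/(z − p_j)) = ∑ n_j · Im p_j / ((z − Re p_j)² + (Im p_j)²)`
over `(0,1)` is a KZ relation. Certificate: ≤ m balancing stages, each the complex Stokes square of
`Ψ(z,w) = ∏ (1 − z(1 − u_j(w)))^{n_j}` with Cayley-rational `u_j(w)`, then `[(0,1), 0]`. -/
def ArgBalancingRelator : Prop :=
  ∀ (m : ℕ) (p : Fin m → ℂ) (n : Fin m → ℤ) (r : KZ.IntegralRep 1),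
    (∀ j, IsAlgebraic ℚ (p j)) →
    (∀ j, ∀ t ∈ Set.Icc (0 : ℝ) 1, p j ≠ (t : ℂ)) →
    ∑ j, (n j : ℝ) * Complex.arg ((p j - 1) / p j) = 0 →
    r.domain = Set.pi Set.univ (fun _ : Fin 1 => Set.Ioo (0 : ℝ) 1) →
    Set.EqOn r.integrand
      (fun x => ∑ j, (n j : ℝ) * ((p j).im / ((x 0 - (p j).re) ^ 2 + (p j).im ^ 2))) r.domain →
    KZ.of r ∈ KZ.relations

/-- TRANSFER C⁺ (cards 1 and 3): the ϖ-free strengthening of the crux. A real rational function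
`p/q` whose coefficients are real algebraic numbers, with `q ≠ 0` on `[0,1]` and `∫₀¹ p/q = 0`, gives a
KZ relation over `(0,1)`. (The crux is the instance `p = P(·,ϖ₀)`, `q = Q(·,ϖ₀)`, coefficients in
`ℚ(ϖ₀) ⊂ ℚ̄ ∩ ℝ`.) Proof plan: partial fractions over `ℚ̄`; Baker (`baker_holds`, PROVED in tree) splits
the vanishing value into `E(1) = E(0)`, modulus loops (`DlogLoopRelator`, item 9135) and argument loops
(`ArgBalancingRelator` / `ArctanArcScissors`). -/
def AlgCoeffKernelDimOne : Prop :=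
  ∀ (p q : Polynomial ℝ) (r : KZ.IntegralRep 1),
    (∀ k, IsAlgebraic ℚ (p.coeff k)) → (∀ k, IsAlgebraic ℚ (q.coeff k)) →
    (∀ t ∈ Set.Icc (0 : ℝ) 1, q.eval t ≠ 0) →
    ∫ t in (0 : ℝ)..1, p.eval t / q.eval t = 0 →
    r.domain = Set.pi Set.univ (fun _ : Fin 1 => Set.Ioo (0 : ℝ) 1) →
    Set.EqOn r.integrand (fun x => p.eval (x 0) / q.eval (x 0)) r.domain →
    KZ.of r ∈ KZ.relations

/-- The transfer is a strengthening: `AlgCoeffKernelDimOne → TateFamilyKernelCurves` (to be proved by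
the line; stated here as a Prop so that the direction is fixed). -/
def TransferImpliesCrux : Prop :=
  AlgCoeffKernelDimOne →
    Summit.KontsevichZagierPeriods.KontsevichZagierPeriods.Theses.InverseLandau.TateFamilyKernelCurves

/-- CARD 2, first lemma (TATE-SLAB LOOP CERTIFICATE). Data: reciprocal root branches
`s_j(ϖ) = 1/p_j(ϖ) = 1 − u_j(ϖ)` of one loop component, given by their real and imaginary parts
`sre j, sim j : ℝ → ℝ`, continuous and `ℚ`-semialgebraic on `[0, ϖ₀]`, vanishing at the Tate point
`ϖ = 0` (poles run to infinity), admissible (`1 − z·s_j(ϖ) ≠ 0` on the closed slab) and satisfying the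
LOOP CONDITION `∑ n_j Arg(1 − s_j(ϖ)) = 0` for every `ϖ ∈ [0, ϖ₀]` (for an exact lattice relation
`n ∈ Λ(F)` this holds identically: it is `0` near the Tate point and locally constant). Conclusion: the
argument part of the loop at the fibre `ϖ₀`, `z ↦ ∑ n_j Im(−s_j(ϖ₀)/(1 − z s_j(ϖ₀)))`, is a KZ relation —
by the complex Stokes square on the slab `[0,1] × [0,ϖ₀]` itself (`B = Im ∂_z log Ψ`, `A = Im ∂_ϖ log Ψ`,
`Ψ = ∏ (1 − z s_j(ϖ))^{n_j}`; `Ψ(·,0) = 1`, `Ψ(0,·) = 1`, `Arg Ψ(1,·) ≡ 0`). -/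
def TateSlabLoopCertificate : Prop :=
  ∀ (m : ℕ) (n : Fin m → ℤ) (sre sim : Fin m → ℝ → ℝ) (ϖ₀ : ℝ) (r : KZ.IntegralRep 1),
    0 < ϖ₀ → IsAlgebraic ℚ ϖ₀ →
    (∀ j, IsSemialgebraicFunOn ℚ {x : Fin 1 → ℝ | x 0 ∈ Set.Icc (0 : ℝ) ϖ₀} (fun x => sre j (x 0))) →
    (∀ j, IsSemialgebraicFunOn ℚ {x : Fin 1 → ℝ | x 0 ∈ Set.Icc (0 : ℝ) ϖ₀} (fun x => sim j (x 0))) →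
    (∀ j, ContinuousOn (sre j) (Set.Icc 0 ϖ₀) ∧ ContinuousOn (sim j) (Set.Icc 0 ϖ₀)) →
    (∀ j, sre j 0 = 0 ∧ sim j 0 = 0) →
    (∀ j, ∀ z ∈ Set.Icc (0 : ℝ) 1, ∀ ϖ ∈ Set.Icc (0 : ℝ) ϖ₀,
        (1 : ℂ) - (z : ℂ) * ((sre j ϖ : ℂ) + (sim j ϖ : ℂ) * Complex.I) ≠ 0) →
    (∀ ϖ ∈ Set.Icc (0 : ℝ) ϖ₀,
        ∑ j, (n j : ℝ) * Complex.arg ((1 : ℂ) - ((sre j ϖ : ℂ) + (sim j ϖ : ℂ) * Complex.I)) = 0) →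
    r.domain = Set.pi Set.univ (fun _ : Fin 1 => Set.Ioo (0 : ℝ) 1) →
    Set.EqOn r.integrand
      (fun x => ∑ j, (n j : ℝ) *
        (-(sim j ϖ₀) / ((1 - x 0 * sre j ϖ₀) ^ 2 + (x 0 * sim j ϖ₀) ^ 2))) r.domain →
    KZ.of r ∈ KZ.relations

/-- CARD 3, first lemma (ARCTAN ARC SCISSORS on the rational circle). Finitely many arcs `(α_k, β_k)`
of the `t`-line with real-algebraic endpoints and integer multiplicities whose total `dt/(1+t²)`-mass
vanishes: the formal combination of the representations `[(α_k, β_k), 1/(1+t²)]` is a KZ relation —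
realised in dimension one by Möbius rotations `t ↦ (t + c)/(1 − c t)` (which preserve `dt/(1+t²)`;
`c = tan(γ/2)` algebraic), split at their pole, and domain additivity (arc concatenation). -/
def ArctanArcScissors : Prop :=
  ∀ (K : ℕ) (α β : Fin K → ℝ) (mult : Fin K → ℤ) (ρ : Fin K → KZ.IntegralRep 1),
    (∀ k, IsAlgebraic ℚ (α k) ∧ IsAlgebraic ℚ (β k) ∧ α k < β k) →
    ∑ k, (mult k : ℝ) * (Real.arctan (β k) - Real.arctan (α k)) = 0 →
    (∀ k, (ρ k).domain = {x : Fin 1 → ℝ | x 0 ∈ Set.Ioo (α k) (β k)} ∧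
        Set.EqOn (ρ k).integrand (fun x => 1 / (1 + (x 0) ^ 2)) (ρ k).domain) →
    ∑ k, mult k • KZ.of (ρ k) ∈ KZ.relations

end Summit.KontsevichZagierPeriods.KontsevichZagierPeriods.Cruxes.TateFamilyKernelCurves.Sketch
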